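import Literature.NumberTheory.LFunctions.WeilFirstPrimeCertificateDataC
import HarnessLib

/-!
# First-prime Weil positivity, stage C: kernel check of the even scaled moments ν_120, ν_122, ν_124, ν_126, ν_128, ν_130

Part of `weilCert3C.check` (`WeilFirstPrimeCertificateDataC.lean`), evaluated by `decide +kernel` and kept in its own
file for kernel time and memory (each declaration is checked separately). Assembled in
`WeilFirstPrimeCertificateCCheck.lean`. Pure proof file; nothing is asserted.
-/

noncomputable section

namespace Literature.NumberTheory.LFunctions

set_option maxHeartbeats 0 in
/-- **Kernel check of the scaled moment `ν_{120}`** of the stage-C first-prime certificate. [folklore] -/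
theorem checkNuAt120_weilCert3C : weilCert3C.checkNuAt 120 = true := by
  decide +kernel

set_option maxHeartbeats 0 in
/-- **Kernel check of the scaled moment `ν_{122}`** of the stage-C first-prime certificate. [folklore] -/
theorem checkNuAt122_weilCert3C : weilCert3C.checkNuAt 122 = true := by
  decide +kernel

set_option maxHeartbeats 0 in
/-- **Kernel check of the scaled moment `ν_{124}`** of the stage-C first-prime certificate. [folklore] -/
theorem checkNuAt124_weilCert3C : weilCert3C.checkNuAt 124 = true := by
  decide +kernel

set_option maxHeartbeats 0 in
/-- **Kernel check of the scaled moment `ν_{126}`** of the stage-C first-prime certificate. [folklore] -/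
theorem checkNuAt126_weilCert3C : weilCert3C.checkNuAt 126 = true := by
  decide +kernel

set_option maxHeartbeats 0 in
/-- **Kernel check of the scaled moment `ν_{128}`** of the stage-C first-prime certificate. [folklore] -/
theorem checkNuAt128_weilCert3C : weilCert3C.checkNuAt 128 = true := by
  decide +kernel

set_option maxHeartbeats 0 in
/-- **Kernel check of the scaled moment `ν_{130}`** of the stage-C first-prime certificate. [folklore] -/
theorem checkNuAt130_weilCert3C : weilCert3C.checkNuAt 130 = true := by
  decide +kernel

end Literature.NumberTheory.LFunctions
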